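import Mathlib.LinearAlgebra.Matrix.Adjugate
import Mathlib.Analysis.SpecialFunctions.Pow.Real
import Mathlib.Data.Set.Card
import HarnessLib

/-!
# Heath-Brown's bound for primitive zeros of a ternary quadratic form in a box

Named fact (`def … : Prop`, CONVENTIONS §4; not proved here): D. R. Heath-Brown, *The density of
rational points on curves and surfaces*, Ann. of Math. 155 (2002), Corollary 2 (the sharpening of the
exponent `1/2` of Heath-Brown's 1997 conic bound to `1/3 + ε`, by the `p`-adic determinant method of
Theorem 3 of that paper): for an integral ternary quadratic form `q` with matrix `M`, `Δ = |det M| ≠ 0`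
and `Δ₀` the highest common factor of the `2 × 2` minors of `M`, the number of PRIMITIVE integer
solutions of `q(x) = 0` in the box `|xᵢ| ≤ Rᵢ` is
`≪_ε d₃(Δ)·{1 + (R₁R₂R₃Δ₀²/Δ)^{1/3+ε}}` (and `d₃(Δ)` may be replaced by `(R₁R₂R₃)^ε`).

We state the slightly WEAKER form in which every sub-polynomial factor is absorbed into one factor
`(R₁R₂R₃·Δ)^δ` with an arbitrary `δ > 0` (it follows from the printed statement by `d₃(Δ) ≪_δ Δ^δ`,
`Δ₀ ∣ Δ` and `t^{1/3+ε} ≤ t^{1/3}·max(1,t)^ε`), and only for forms `x ↦ xᵀ M x` with an INTEGRAL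
symmetric matrix `M` (even off-diagonal coefficients; an arbitrary integral form `q` is handled by
applying the statement to `2M`, which has the same zeros). This is the shape in which the bound is
consumed by conic censuses (e.g. Kane, arXiv:1104.2635, Prop. 9 uses the 1997 exponent `1/2`; the
tree's `Literature.NumberTheory.DiophantineGeometry.SquarefulDet.fiberBound` is the DIAGONAL case with
pairwise coprime coefficients, where `Δ₀ = 1`).

Deliberately NOT here: the proof (L–XL: Theorem 3's determinant method for plane conics plus the
covolume computation giving `Δ₀²/Δ`; the tree's `SquarefulSumsDetMethod.lean` is the template for the
first-order Taylor step), Theorem 3 itself (curves of degree `d` in unequal boxes), and the later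
removal of the `ε` (Broberg–Salberger).
-/

namespace Literature.NumberTheory.DiophantineGeometry

open Matrix Finset

/-- The highest common factor `Δ₀(M)` of the `2 × 2` minors of a `3 × 3` integral matrix, i.e. of the
entries of its adjugate. [cite: Heathbrown2002, Cor. 2] -/
def minorGcd (M : Matrix (Fin 3) (Fin 3) ℤ) : ℤ :=
  (Finset.univ : Finset (Fin 3 × Fin 3)).gcd fun ij => M.adjugate ij.1 ij.2

/-- The set of PRIMITIVE integer zeros of the quadratic form `x ↦ xᵀ M x` in the box `|xᵢ| ≤ Bᵢ`
(primitive: every common divisor of the coordinates is a unit; in particular `x ≠ 0`). [cite: Heathbrown2002, Cor. 2] -/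
def primitiveConicZeros (M : Matrix (Fin 3) (Fin 3) ℤ) (B : Fin 3 → ℕ) : Set (Fin 3 → ℤ) :=
  {x | (∀ i, |x i| ≤ B i) ∧ (∀ d : ℤ, (∀ i, d ∣ x i) → IsUnit d) ∧ dotProduct x (M.mulVec x) = 0}

/-- **Heath-Brown 2002, Corollary 2** (primitive zeros of a nonsingular ternary quadratic form in a box),
in `δ`-absorbed form: for every `δ > 0` there is `C` such that for every symmetric integral `3 × 3` matrix
`M` with `det M ≠ 0` and every box `B` (`Bᵢ ≥ 1`), the primitive zeros of `xᵀMx` in the box number at most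
`C · (B₀B₁B₂·|det M|)^δ · (1 + (B₀B₁B₂·Δ₀(M)²/|det M|)^{1/3})`. [cite: Heathbrown2002, Cor. 2] -/
def TernaryConicPointBound : Prop :=
  ∀ δ : ℝ, 0 < δ → ∃ C : ℝ, ∀ M : Matrix (Fin 3) (Fin 3) ℤ, M.IsSymm → M.det ≠ 0 →
    ∀ B : Fin 3 → ℕ, (∀ i, 1 ≤ B i) →
      ((primitiveConicZeros M B).ncard : ℝ) ≤
        C * (((B 0 : ℝ) * B 1 * B 2) * |(M.det : ℝ)|) ^ δ *
          (1 + (((B 0 : ℝ) * B 1 * B 2) * ((minorGcd M : ℝ)) ^ 2 / |(M.det : ℝ)|) ^ (1 / 3 : ℝ))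

end Literature.NumberTheory.DiophantineGeometry
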